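import Summits.CriticalPhenomena.SAWScalingLimit.Theorems.SAWWeldingIdentificationWeldingSetupMonotone
import Summits.CriticalPhenomena.SAWScalingLimit.Theorems.SAWWeldingIdentificationWeldingSetupArcs

/-!
# The core orientation lemma for nested Dobrushin domains
# (route `SAWWeldingIdentification`, helper for item `WeldingSetup`, stmt-CriticalPhenomena-4504)

For nested Dobrushin domains `D ⊆ E` with the same first marked point `a`, uniformised by chordal
maps `φ : (ℍ; 0, ∞) → (D; a, ·)` and `Φ : (ℍ; 0, ∞) → (E; a, ·)`, the holomorphic map
`g = Φ⁻¹ ∘ φ : ℍ → ℍ` has boundary value `0` at `0` and real boundary values along any real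
half-line that `φ` sends into `Φ(ℝ)`; by the boundary monotonicity lemma
(`strictMonoOn_boundary_of_mapsTo_upperHalfPlane`, Schwarz reflection) these increase. Hence
`φ((-∞,0)) ⊆ Φ((0,∞))` and `φ((0,∞)) ⊆ Φ((-∞,0))` are both impossible
(`false_of_image_Iio_subset_image_Ioi`, `false_of_image_Ioi_subset_image_Iio`). This is the
analytic core of the orientation rule for welding configurations (file `…WeldingSetupSign`).

References: Ch. Pommerenke, *Boundary Behaviour of Conformal Maps* (1992), Thm. 2.6 and §2.3.
-/

noncomputable section

namespace Summit.CriticalPhenomena.SAWScalingLimit.Theorems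

open Set Filter Topology Complex Metric Function
open UpperHalfPlane (upperHalfPlaneSet)
open Literature.Probability.RandomPlanarGeometry Literature.Topology.PlaneTopology

/-! ### The core orientation lemma for nested Dobrushin domains -/

section Core

variable {D E : DobrushinDomain} (φ : ConformalEquiv upperHalfPlaneSet D.carrier)
  (Φ : ConformalEquiv upperHalfPlaneSet E.carrier)

/-- `φ` tends to its boundary extension within `ℍ` at every real point (Carathéodory). [folklore] -/
theorem tendsto_boundaryExtension_ofReal (x : ℝ) :
    Tendsto φ (𝓝[upperHalfPlaneSet] (x : ℂ)) (𝓝 (φ.boundaryExtension x)) := by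
  obtain ⟨Ψ, hΨ⟩ := JordanDomain.exists_isDiscExtension
    JordanDomain.exists_continuousOn_extension_holds φ (D := D.toJordanDomain)
  exact hΨ.tendsto_nhdsWithin (by simp)

/-- **Core orientation lemma, first pattern.** Let `D ⊆ E` be Dobrushin domains with the same
first marked point `a`, uniformised by chordal maps `φ : (ℍ; 0, ∞) → (D; a, ·)` and
`Φ : (ℍ; 0, ∞) → (E; a, ·)`. Then the boundary correspondence of `φ` cannot send the negative
half-line into the `Φ`-image of the positive half-line. (Otherwise `g = Φ⁻¹ ∘ φ : ℍ → ℍ` would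
have boundary value `0` at `0` and positive increasing boundary values on `(-∞, 0)`,
`false_of_boundary_Iio_pos`.) [folklore] -/
theorem false_of_image_Iio_subset_image_Ioi (hφ : D.IsChordalUniformizing φ)
    (hΦ : E.IsChordalUniformizing Φ) (hDE : D.carrier ⊆ E.carrier) (ha : D.pt 0 = E.pt 0)
    (himg : (fun t : ℝ => φ.boundaryExtension t) '' Iio 0 ⊆
      (fun t : ℝ => Φ.boundaryExtension t) '' Ioi 0) : False := by
  obtain ⟨Ψ, hΨc, hΨeq, hbij, -⟩ :=
    JordanDomain.exists_continuousOn_extension_holds E.toJordanDomain (cayley.symm.trans Φ)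
  have hinjΨ : InjOn Ψ (closedBall 0 1) := hbij.injOn
  -- boundary preimages under `Φ` of the points `φ(t)`, `t < 0`
  have hex : ∀ t : ℝ, t < 0 → ∃ r : ℝ, 0 < r ∧ Φ.boundaryExtension r = φ.boundaryExtension t :=
    fun t ht => by
      obtain ⟨r, hr, hrt⟩ := himg ⟨t, ht, rfl⟩
      exact ⟨r, hr, hrt⟩
  choose! r hr using hex
  set gb : ℝ → ℝ := fun t => if t < 0 then r t else 0 with hgb
  set g : ℂ → ℂ := fun z => Φ.symm (φ z) with hg
  have hmapsφ : MapsTo φ upperHalfPlaneSet E.carrier := fun z hz => hDE (φ.mapsTo hz)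
  have hgd : DifferentiableOn ℂ g upperHalfPlaneSet :=
    Φ.symm.differentiableOn_coe.comp φ.differentiableOn_coe hmapsφ
  have hgmaps : MapsTo g upperHalfPlaneSet upperHalfPlaneSet := fun z hz =>
    Φ.symm_mapsTo (hmapsφ hz)
  -- boundary values of `g`
  have hlim : ∀ t : ℝ, t ≤ 0 → Tendsto g (𝓝[upperHalfPlaneSet] (t : ℂ)) (𝓝 ((gb t : ℝ) : ℂ)) := by
    intro t ht
    rcases ht.lt_or_eq with hlt | rfl
    · have hgbt : gb t = r t := if_pos hlt
      rw [hgbt]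
      obtain ⟨-, hrt⟩ := hr t hlt
      have h1 : Tendsto φ (𝓝[upperHalfPlaneSet] (t : ℂ)) (𝓝[E.carrier] (φ.boundaryExtension t)) :=
        tendsto_nhdsWithin_iff.2 ⟨tendsto_boundaryExtension_ofReal φ t,
          eventually_nhdsWithin_of_forall fun z hz => hmapsφ hz⟩
      have h2 : Tendsto Φ.symm (𝓝[E.carrier] (Φ.boundaryExtension (r t))) (𝓝 ((r t : ℝ) : ℂ)) :=
        JordanDomain.tendsto_symm_nhds Φ hΨc hΨeq hinjΨ (tendsto_boundaryExtension_ofReal Φ (r t))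
      rw [hrt] at h2
      exact h2.comp h1
    · have hgb0 : gb 0 = 0 := if_neg (lt_irrefl 0)
      rw [hgb0]
      have h1 : Tendsto φ (𝓝[upperHalfPlaneSet] ((0 : ℝ) : ℂ)) (𝓝[E.carrier] (E.pt 0)) := by
        rw [ofReal_zero, ← ha]
        exact tendsto_nhdsWithin_iff.2 ⟨hφ.1, eventually_nhdsWithin_of_forall fun z hz => hmapsφ hz⟩
      have h2 : Tendsto Φ.symm (𝓝[E.carrier] (E.pt 0)) (𝓝 ((0 : ℝ) : ℂ)) :=
        JordanDomain.tendsto_symm_nhds Φ hΨc hΨeq hinjΨ (x := 0) (by exact_mod_cast hΦ.1)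
      exact h2.comp h1
  have h0 : gb 0 = 0 := if_neg (lt_irrefl 0)
  have hinj : InjOn gb (Iio 0) := by
    intro t ht t' ht' heq
    have e1 : gb t = r t := if_pos ht
    have e2 : gb t' = r t' := if_pos ht'
    rw [e1, e2] at heq
    have h := (hr t ht).2
    rw [heq, (hr t' ht').2] at h
    have := JordanDomain.injOn_boundaryExtension φ (by simp) (by simp) h
    exact_mod_cast this.symm
  have hpos : ∀ t : ℝ, t < 0 → 0 < gb t := fun t ht => by
    rw [show gb t = r t from if_pos ht]
    exact (hr t ht).1
  exact false_of_boundary_Iio_pos hgd hgmaps hlim h0 hinj hpos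

/-- **Core orientation lemma, second pattern**: the boundary correspondence of `φ` cannot send
the positive half-line into the `Φ`-image of the negative half-line
(`false_of_boundary_Ioi_neg`). [folklore] -/
theorem false_of_image_Ioi_subset_image_Iio (hφ : D.IsChordalUniformizing φ)
    (hΦ : E.IsChordalUniformizing Φ) (hDE : D.carrier ⊆ E.carrier) (ha : D.pt 0 = E.pt 0)
    (himg : (fun t : ℝ => φ.boundaryExtension t) '' Ioi 0 ⊆
      (fun t : ℝ => Φ.boundaryExtension t) '' Iio 0) : False := by
  obtain ⟨Ψ, hΨc, hΨeq, hbij, -⟩ :=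
    JordanDomain.exists_continuousOn_extension_holds E.toJordanDomain (cayley.symm.trans Φ)
  have hinjΨ : InjOn Ψ (closedBall 0 1) := hbij.injOn
  have hex : ∀ t : ℝ, 0 < t → ∃ r : ℝ, r < 0 ∧ Φ.boundaryExtension r = φ.boundaryExtension t :=
    fun t ht => by
      obtain ⟨r, hr, hrt⟩ := himg ⟨t, ht, rfl⟩
      exact ⟨r, hr, hrt⟩
  choose! r hr using hex
  set gb : ℝ → ℝ := fun t => if 0 < t then r t else 0 with hgb
  set g : ℂ → ℂ := fun z => Φ.symm (φ z) with hg
  have hmapsφ : MapsTo φ upperHalfPlaneSet E.carrier := fun z hz => hDE (φ.mapsTo hz)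
  have hgd : DifferentiableOn ℂ g upperHalfPlaneSet :=
    Φ.symm.differentiableOn_coe.comp φ.differentiableOn_coe hmapsφ
  have hgmaps : MapsTo g upperHalfPlaneSet upperHalfPlaneSet := fun z hz =>
    Φ.symm_mapsTo (hmapsφ hz)
  have hlim : ∀ t : ℝ, 0 ≤ t → Tendsto g (𝓝[upperHalfPlaneSet] (t : ℂ)) (𝓝 ((gb t : ℝ) : ℂ)) := by
    intro t ht
    rcases ht.lt_or_eq with hlt | h0
    · have hgbt : gb t = r t := if_pos hlt
      rw [hgbt]
      obtain ⟨-, hrt⟩ := hr t hlt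
      have h1 : Tendsto φ (𝓝[upperHalfPlaneSet] (t : ℂ)) (𝓝[E.carrier] (φ.boundaryExtension t)) :=
        tendsto_nhdsWithin_iff.2 ⟨tendsto_boundaryExtension_ofReal φ t,
          eventually_nhdsWithin_of_forall fun z hz => hmapsφ hz⟩
      have h2 : Tendsto Φ.symm (𝓝[E.carrier] (Φ.boundaryExtension (r t))) (𝓝 ((r t : ℝ) : ℂ)) :=
        JordanDomain.tendsto_symm_nhds Φ hΨc hΨeq hinjΨ (tendsto_boundaryExtension_ofReal Φ (r t))
      rw [hrt] at h2
      exact h2.comp h1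
    · subst h0
      have hgb0 : gb 0 = 0 := if_neg (lt_irrefl 0)
      rw [hgb0]
      have h1 : Tendsto φ (𝓝[upperHalfPlaneSet] ((0 : ℝ) : ℂ)) (𝓝[E.carrier] (E.pt 0)) := by
        rw [ofReal_zero, ← ha]
        exact tendsto_nhdsWithin_iff.2 ⟨hφ.1, eventually_nhdsWithin_of_forall fun z hz => hmapsφ hz⟩
      have h2 : Tendsto Φ.symm (𝓝[E.carrier] (E.pt 0)) (𝓝 ((0 : ℝ) : ℂ)) :=
        JordanDomain.tendsto_symm_nhds Φ hΨc hΨeq hinjΨ (x := 0) (by exact_mod_cast hΦ.1)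
      exact h2.comp h1
  have h0 : gb 0 = 0 := if_neg (lt_irrefl 0)
  have hinj : InjOn gb (Ioi 0) := by
    intro t ht t' ht' heq
    have e1 : gb t = r t := if_pos ht
    have e2 : gb t' = r t' := if_pos ht'
    rw [e1, e2] at heq
    have h := (hr t ht).2
    rw [heq, (hr t' ht').2] at h
    have := JordanDomain.injOn_boundaryExtension φ (by simp) (by simp) h
    exact_mod_cast this.symm
  have hneg : ∀ t : ℝ, 0 < t → gb t < 0 := fun t ht => by
    rw [show gb t = r t from if_pos ht]
    exact (hr t ht).1
  exact false_of_boundary_Ioi_neg hgd hgmaps hlim h0 hinj hneg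

end Core

end Summit.CriticalPhenomena.SAWScalingLimit.Theorems
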